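import Mathlib
import HarnessLib
import Summits.Ventures.LatticeQCDFlow.Scoring.DoeblinAutocorrelation
import Summits.Ventures.LatticeQCDFlow.Scoring.VarianceOfTheMean

/-!
# The windowless τ law of a Markov kernel minorised by its own invariant law (general state
# space): Poisson solution, Green–Kubo `Σ_t C_f(t) = ⟨f, h⟩_π`, `τ_int(f) = ⟨f, h⟩_π / Var_π f − 1/2`

HONEST FRAMING: exact (Metropolis-corrected) sampling algorithms for lattice gauge theory;
figures of merit are autocorrelation/cost numbers at stated couplings and volumes; no
continuum-physics claim.

Venture `LatticeQCDFlow` (cell pub-lqcd), topic `Scoring`; FANOUT row 8 (`s0-cpn-nemc`, GEN-10).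
NEW WORK of the cell (elementary: telescoping sums, a geometric series, dominated convergence),
not a published result: the general-state-space form of the finite-pool windowless law
`Scoring/IMHGreenKubo.lean` (`imh_greenKubo_hasSum`, `imh_tauInt_eq`, `imh_poisson_exists`), over
the groundwork `Scoring/KernelTransitionOperator.lean` (`kop`, `autocov`,
`iterate_kop_eq_of_centred`) and the envelope `Scoring/DoeblinAutocorrelation.lean`; published
input: only the Literature residual kernel of Doeblin's theorem (Meyn–Tweedie Thm 16.2.4), via them.

## Content (`κ` Markov, `π` an invariant probability law, `κ(x, B) ≥ ε π(B)` with `ε > 0`;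
## observables bounded measurable; `f` `π`-centred)

* **`abs_iterate_kop_le_of_doeblin`** — SUP-NORM DECAY of centred observables:
  `|(kop κ)^[t] f (x)| ≤ (1 − ε/2)ᵗ · C` for `|f| ≤ C` (residual kernel at the lowered constant `ε/2`).
* `sum_autocov_eq_of_poisson` — FINITE GREEN–KUBO: if `h` (bounded measurable) solves
  `h − kop κ h = f` then `Σ_{t<T} C_f(t) = ⟨f, h⟩_π − ⟨f, Kᵀh⟩_π`; the boundary term `→ 0`
  (`tendsto_integral_mul_iterate_kop`).
* **`greenKubo_hasSum_of_poisson`** — `Σ_{t ≥ 0} ∫ f · (kop κ)^[t] f dπ = ∫ f h dπ` (`HasSum`);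
  `poisson_inner_eq` — `⟨f, h⟩_π` is the same for every bounded measurable Poisson solution;
  **`tauInt_eq_of_poisson`** — on the tree's `Scoring.tauInt`:
  `τ_int(f) = ∫ f h dπ / ∫ f² dπ − 1/2` (`Var_π f ≠ 0`) — no window, no truncation.
* **`poisson_exists_of_doeblin`** — a bounded measurable Poisson solution EXISTS for every bounded
  measurable centred `f`: the Neumann series `h = Σ_t (kop κ)^[t] f`, `|h| ≤ 2C/ε` (pointwise
  absolutely convergent by the sup-norm decay; the equation by dominated convergence).
* `summable_moment_acf_of_doeblin`, **`tendsto_tauIntN_of_doeblin`** — row 11's finite-`N`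
  variance-of-the-mean time converges, `τ_N → τ_int` (`Scoring.tendsto_tauIntN` with its moment
  hypothesis `Σ (t+1)|ρ_{t+1}| < ∞` discharged by the envelope), for every such observable.
Instantiated on the exact flow-MCMC sampler (`ε = e^{−2δ}`) in `Scoring/FlowSamplerAutocorrelation.lean`:
the kernel form of the flow seat's IMH-LAW (T2) (finite pools: `imh_tauInt_eq`).
-/

noncomputable section

namespace Summit.Ventures.LatticeQCDFlow.Scoring

open MeasureTheory ProbabilityTheory Filter Literature.Probability.MarkovChains
open scoped ENNReal Topology

variable {Ω : Type*} [MeasurableSpace Ω]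
variable {κ : Kernel Ω Ω} [IsMarkovKernel κ] {π : Measure Ω} [IsProbabilityMeasure π] {ε : ℝ≥0∞}

/-! ### Sup-norm decay of centred observables -/

omit [IsMarkovKernel κ] [IsProbabilityMeasure π] in
/-- A minorisation constant may be lowered. -/
theorem doeblin_mono (hmin : ∀ x {B : Set Ω}, MeasurableSet B → ε * π B ≤ κ x B) {ε' : ℝ≥0∞}
    (h : ε' ≤ ε) : ∀ x {B : Set Ω}, MeasurableSet B → ε' * π B ≤ κ x B :=
  fun x _ hB => (mul_le_mul' h le_rfl).trans (hmin x hB)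

/-- Bookkeeping for the lowered constant: `ε/2 < 1`, `0 ≤ 1 − (ε/2).toReal < 1`,
`(1 − ε/2).toReal = 1 − (ε/2).toReal` and `(ε/2).toReal = ε.toReal/2 > 0`, for `0 < ε ≤ 1`. -/
theorem half_const_bounds (hmin : ∀ x {B : Set Ω}, MeasurableSet B → ε * π B ≤ κ x B)
    (hε0 : 0 < ε) :
    ε / 2 < 1 ∧ 0 ≤ 1 - (ε / 2).toReal ∧ 1 - (ε / 2).toReal < 1 ∧
      (1 - ε / 2).toReal = 1 - (ε / 2).toReal ∧ (ε / 2).toReal = ε.toReal / 2 ∧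
      0 < ε.toReal := by
  have hε1 : ε ≤ 1 := eps_le_one_of_doeblin hmin
  have hεtop : ε ≠ ⊤ := ne_top_of_le_ne_top ENNReal.one_ne_top hε1
  have hr : (ε / 2).toReal = ε.toReal / 2 := by
    rw [ENNReal.toReal_div, ENNReal.toReal_ofNat]
  have hεr0 : 0 < ε.toReal := ENNReal.toReal_pos hε0.ne' hεtop
  have hεr1 : ε.toReal ≤ 1 := by
    have := ENNReal.toReal_mono ENNReal.one_ne_top hε1
    rwa [ENNReal.toReal_one] at this
  have hhalf_le : ε / 2 ≤ 1 := (ENNReal.half_le_self).trans hε1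
  have hhalf_lt : ε / 2 < 1 := by
    refine lt_of_le_of_ne hhalf_le fun h => ?_
    have h' := congrArg ENNReal.toReal h
    rw [hr, ENNReal.toReal_one] at h'
    linarith
  refine ⟨hhalf_lt, ?_, ?_, ?_, hr, hεr0⟩
  · rw [hr]; linarith
  · rw [hr]; linarith
  · rw [ENNReal.toReal_sub_of_le hhalf_le ENNReal.one_ne_top, ENNReal.toReal_one]

/-- **Sup-norm decay of centred observables**: `|(kop κ)^[t] f (x)| ≤ (1 − (ε/2).toReal)ᵗ · C` for a
bounded measurable `π`-centred `f` (`|f| ≤ C`), `ε > 0`. -/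
theorem abs_iterate_kop_le_of_doeblin (hπ : Kernel.Invariant κ π)
    (hmin : ∀ x {B : Set Ω}, MeasurableSet B → ε * π B ≤ κ x B) (hε0 : 0 < ε) {f : Ω → ℝ}
    (hf : Measurable f) {C : ℝ} (hC : ∀ x, |f x| ≤ C) (hf0 : ∫ x, f x ∂π = 0) (t : ℕ) (x : Ω) :
    |(kop κ)^[t] f x| ≤ (1 - (ε / 2).toReal) ^ t * C := by
  obtain ⟨hlt, hl0, -, hr, -, -⟩ := half_const_bounds hmin hε0
  have hmin' := doeblin_mono hmin (ENNReal.half_le_self (a := ε))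
  haveI := Doeblin.isMarkovKernel_residualKernel (κ := κ) (ν := π) (hmin := hmin') hlt
  rw [iterate_kop_eq_of_centred (hmin := hmin') hπ hlt hf hC hf0 t]
  obtain ⟨-, hb⟩ :=
    iterate_kop_bounded_measurable (Doeblin.residualKernel κ π (ε / 2) hmin') hf hC t
  show |(1 - ε / 2).toReal ^ t * _| ≤ _
  rw [abs_mul, hr, abs_of_nonneg (pow_nonneg hl0 t)]
  exact mul_le_mul_of_nonneg_left (hb x) (pow_nonneg hl0 t)

/-! ### Bookkeeping: constants and differences under `kop` -/

omit [IsProbabilityMeasure π] in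
/-- `kop` of a constant is the constant (Markov kernel). -/
theorem kop_const (a : ℝ) : kop κ (fun _ => a) = fun _ => a := by
  funext x
  unfold kop
  rw [integral_const, probReal_univ, one_smul]

omit [IsProbabilityMeasure π] in
/-- Iterates commute with subtracting a constant:
`(kop κ)^[t] (g − a) = (kop κ)^[t] g − a` for bounded measurable `g`. -/
theorem iterate_kop_sub_const {g : Ω → ℝ} (hg : Measurable g) {C : ℝ} (hC : ∀ x, |g x| ≤ C)
    (a : ℝ) : ∀ t : ℕ, (kop κ)^[t] (fun x => g x - a) = fun x => (kop κ)^[t] g x - a := by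
  intro t
  induction t with
  | zero => rfl
  | succ t ih =>
    obtain ⟨hm, hb⟩ := iterate_kop_bounded_measurable κ hg hC t
    rw [Function.iterate_succ_apply', ih, Function.iterate_succ_apply']
    funext x
    show ∫ y, ((kop κ)^[t] g y - a) ∂(κ x) = (∫ y, (kop κ)^[t] g y ∂(κ x)) - a
    rw [integral_sub (integrable_of_bounded _ hm hb) (integrable_const a), integral_const,
      probReal_univ, one_smul]

omit [IsProbabilityMeasure π] in
/-- Along a Poisson solution `h − kop κ h = f` (both bounded measurable):
`(kop κ)^[t] f = (kop κ)^[t] h − (kop κ)^[t+1] h`. -/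
theorem iterate_kop_poisson {f h : Ω → ℝ} (hh : Measurable h) {Ch : ℝ} (hCh : ∀ x, |h x| ≤ Ch)
    (hpois : ∀ x, h x - kop κ h x = f x) :
    ∀ t : ℕ, (kop κ)^[t] f = fun x => (kop κ)^[t] h x - (kop κ)^[t + 1] h x := by
  intro t
  induction t with
  | zero => funext x; exact (hpois x).symm
  | succ t ih =>
    obtain ⟨hm, hb⟩ := iterate_kop_bounded_measurable κ hh hCh t
    obtain ⟨hm1, hb1⟩ := iterate_kop_bounded_measurable κ hh hCh (t + 1)
    rw [Function.iterate_succ_apply', ih]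
    funext x
    show ∫ y, ((kop κ)^[t] h y - (kop κ)^[t + 1] h y) ∂(κ x) = _
    rw [integral_sub (integrable_of_bounded _ hm hb) (integrable_of_bounded _ hm1 hb1),
      Function.iterate_succ_apply' (kop κ) (t + 1), Function.iterate_succ_apply' (kop κ) t]
    rfl

/-! ### Green–Kubo from a Poisson solution -/

/-- **Finite Green–Kubo**: if `h` (bounded measurable) solves `h − kop κ h = f` (`f` bounded
measurable), then `Σ_{t<T} ∫ f · (kop κ)^[t] f dπ = ∫ f h dπ − ∫ f · (kop κ)^[T] h dπ`. -/
theorem sum_autocov_eq_of_poisson {f h : Ω → ℝ} (hf : Measurable f) {Cf : ℝ}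
    (hCf : ∀ x, |f x| ≤ Cf) (hh : Measurable h) {Ch : ℝ} (hCh : ∀ x, |h x| ≤ Ch)
    (hpois : ∀ x, h x - kop κ h x = f x) (T : ℕ) :
    ∑ t ∈ Finset.range T, autocov κ π f t
      = ∫ x, f x * h x ∂π - ∫ x, f x * (kop κ)^[T] h x ∂π := by
  have hCf0 : ∀ x, 0 ≤ Cf := fun x => (abs_nonneg _).trans (hCf x)
  have hint : ∀ t, Integrable (fun x => f x * (kop κ)^[t] h x) π := by
    intro t
    obtain ⟨hmt, hbt⟩ := iterate_kop_bounded_measurable κ hh hCh t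
    exact integrable_of_bounded π (hf.mul hmt) (C := Cf * Ch) fun x => by
      rw [abs_mul]
      exact mul_le_mul (hCf x) (hbt x) (abs_nonneg _) (hCf0 x)
  have hstep : ∀ t, autocov κ π f t
      = ∫ x, f x * (kop κ)^[t] h x ∂π - ∫ x, f x * (kop κ)^[t + 1] h x ∂π := by
    intro t
    unfold autocov
    rw [← integral_sub (hint t) (hint (t + 1)), iterate_kop_poisson hh hCh hpois t]
    refine integral_congr_ae (ae_of_all _ fun x => ?_)
    show f x * ((kop κ)^[t] h x - (kop κ)^[t + 1] h x) = _
    ring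
  rw [Finset.sum_congr rfl fun t _ => hstep t]
  exact Finset.sum_range_sub' (fun t => ∫ x, f x * (kop κ)^[t] h x ∂π) T

/-- **The boundary term vanishes**: `∫ f · (kop κ)^[T] h dπ → 0` for `f` bounded measurable centred
and `h` bounded measurable (the centred part `h − π(h)` decays in sup norm, the constant part is
invisible to `f`). -/
theorem tendsto_integral_mul_iterate_kop (hπ : Kernel.Invariant κ π)
    (hmin : ∀ x {B : Set Ω}, MeasurableSet B → ε * π B ≤ κ x B) (hε0 : 0 < ε) {f h : Ω → ℝ}
    (hf : Measurable f) {Cf : ℝ} (hCf : ∀ x, |f x| ≤ Cf) (hf0 : ∫ x, f x ∂π = 0)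
    (hh : Measurable h) {Ch : ℝ} (hCh : ∀ x, |h x| ≤ Ch) :
    Tendsto (fun T => ∫ x, f x * (kop κ)^[T] h x ∂π) atTop (𝓝 0) := by
  obtain ⟨-, hl0, hl1, -, -, -⟩ := half_const_bounds hmin hε0
  have hCf0 : ∀ x, 0 ≤ Cf := fun x => (abs_nonneg _).trans (hCf x)
  obtain ⟨x0⟩ := nonempty_of_isProbabilityMeasure π
  -- the centred part of `h`
  set m : ℝ := ∫ x, h x ∂π with hm
  have hcm : Measurable fun x => h x - m := hh.sub measurable_const
  have hcb : ∀ x, |h x - m| ≤ Ch + |m| := fun x =>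
    (abs_sub _ _).trans (add_le_add (hCh x) le_rfl)
  have hc0 : ∫ x, (h x - m) ∂π = 0 := by
    rw [integral_sub (integrable_of_bounded π hh hCh) (integrable_const m), integral_const,
      probReal_univ, one_smul, hm, sub_self]
  have hdecay := fun T x => abs_iterate_kop_le_of_doeblin hπ hmin hε0 hcm hcb hc0 T x
  -- `∫ f · Kᵀ h = ∫ f · Kᵀ (h − m)` since `∫ f = 0`
  have hsplit : ∀ T, ∫ x, f x * (kop κ)^[T] h x ∂π
      = ∫ x, f x * (kop κ)^[T] (fun y => h y - m) x ∂π := by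
    intro T
    obtain ⟨hmT, hbT⟩ := iterate_kop_bounded_measurable κ hcm hcb T
    have hfun := iterate_kop_sub_const (κ := κ) hh hCh m T
    have hpt : ∀ x, f x * (kop κ)^[T] h x = f x * (kop κ)^[T] (fun y => h y - m) x + m * f x := by
      intro x
      rw [hfun]
      ring
    have hi1 : Integrable (fun x => f x * (kop κ)^[T] (fun y => h y - m) x) π :=
      integrable_of_bounded π (hf.mul hmT) (C := Cf * (Ch + |m|)) fun x => by
        rw [abs_mul]
        exact mul_le_mul (hCf x) (hbT x) (abs_nonneg _) (hCf0 x)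
    have hi2 : Integrable (fun x => m * f x) π := (integrable_of_bounded π hf hCf).const_mul m
    rw [integral_congr_ae (ae_of_all _ hpt), integral_add hi1 hi2, integral_const_mul, hf0,
      mul_zero, add_zero]
  -- bound and squeeze
  have hbound : ∀ T, |∫ x, f x * (kop κ)^[T] h x ∂π|
      ≤ Cf * (Ch + |m|) * (1 - (ε / 2).toReal) ^ T := by
    intro T
    rw [hsplit T]
    calc |∫ x, f x * (kop κ)^[T] (fun y => h y - m) x ∂π|
        = ‖∫ x, f x * (kop κ)^[T] (fun y => h y - m) x ∂π‖ := (Real.norm_eq_abs _).symm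
      _ ≤ Cf * ((1 - (ε / 2).toReal) ^ T * (Ch + |m|)) * π.real Set.univ :=
          norm_integral_le_of_norm_le_const (ae_of_all _ fun x => by
            rw [Real.norm_eq_abs, abs_mul]
            exact mul_le_mul (hCf x) (hdecay T x) (abs_nonneg _) (hCf0 x))
      _ = Cf * (Ch + |m|) * (1 - (ε / 2).toReal) ^ T := by rw [probReal_univ, mul_one]; ring
  have hg : Tendsto (fun T : ℕ => Cf * (Ch + |m|) * (1 - (ε / 2).toReal) ^ T) atTop (𝓝 0) := by
    simpa using (tendsto_pow_atTop_nhds_zero_of_lt_one hl0 hl1).const_mul (Cf * (Ch + |m|))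
  exact squeeze_zero_norm (fun T => by rw [Real.norm_eq_abs]; exact hbound T) hg

/-- **Green–Kubo (general state space).**  If `π` is an invariant probability law of the Markov
kernel `κ`, `κ(x, ·) ≥ ε π` with `ε > 0`, `f` is bounded measurable and `π`-centred, and `h` is a
bounded measurable solution of the Poisson equation `h − kop κ h = f`, then
`Σ_{t ≥ 0} ∫ f · (kop κ)^[t] f dπ = ∫ f h dπ`. -/
theorem greenKubo_hasSum_of_poisson (hπ : Kernel.Invariant κ π)
    (hmin : ∀ x {B : Set Ω}, MeasurableSet B → ε * π B ≤ κ x B) (hε0 : 0 < ε) {f h : Ω → ℝ}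
    (hf : Measurable f) {Cf : ℝ} (hCf : ∀ x, |f x| ≤ Cf) (hf0 : ∫ x, f x ∂π = 0)
    (hh : Measurable h) {Ch : ℝ} (hCh : ∀ x, |h x| ≤ Ch) (hpois : ∀ x, h x - kop κ h x = f x) :
    HasSum (fun t => autocov κ π f t) (∫ x, f x * h x ∂π) := by
  -- summable by the envelope
  have henv := fun t => abs_autocov_le_of_doeblin hπ hmin hf hCf hf0 t
  have hl0 : 0 ≤ 1 - ε.toReal := one_sub_toReal_nonneg_of_doeblin hmin
  obtain ⟨-, -, -, -, -, hεr0⟩ := half_const_bounds hmin hε0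
  have hl1 : 1 - ε.toReal < 1 := by linarith
  have hsum : Summable fun t => autocov κ π f t :=
    Summable.of_norm_bounded
      ((summable_geometric_of_lt_one hl0 hl1).mul_right (∫ x, f x ^ 2 ∂π)) fun t => by
        rw [Real.norm_eq_abs]; exact henv t
  rw [hsum.hasSum_iff_tendsto_nat]
  have hpart : (fun T => ∑ t ∈ Finset.range T, autocov κ π f t)
      = fun T => ∫ x, f x * h x ∂π - ∫ x, f x * (kop κ)^[T] h x ∂π :=
    funext fun T => sum_autocov_eq_of_poisson hf hCf hh hCh hpois T
  rw [hpart]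
  simpa using (tendsto_integral_mul_iterate_kop hπ hmin hε0 hf hCf hf0 hh hCh).const_sub
    (∫ x, f x * h x ∂π)

/-- The Green–Kubo functional `⟨f, h⟩_π` does not depend on WHICH bounded measurable Poisson
solution is used. -/
theorem poisson_inner_eq (hπ : Kernel.Invariant κ π)
    (hmin : ∀ x {B : Set Ω}, MeasurableSet B → ε * π B ≤ κ x B) (hε0 : 0 < ε) {f h h' : Ω → ℝ}
    (hf : Measurable f) {Cf : ℝ} (hCf : ∀ x, |f x| ≤ Cf) (hf0 : ∫ x, f x ∂π = 0)
    (hh : Measurable h) {Ch : ℝ} (hCh : ∀ x, |h x| ≤ Ch) (hpois : ∀ x, h x - kop κ h x = f x)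
    (hh' : Measurable h') {Ch' : ℝ} (hCh' : ∀ x, |h' x| ≤ Ch')
    (hpois' : ∀ x, h' x - kop κ h' x = f x) :
    ∫ x, f x * h x ∂π = ∫ x, f x * h' x ∂π :=
  (greenKubo_hasSum_of_poisson hπ hmin hε0 hf hCf hf0 hh hCh hpois).unique
    (greenKubo_hasSum_of_poisson hπ hmin hε0 hf hCf hf0 hh' hCh' hpois')

/-- **The windowless τ law (general state space)** on the tree's `Scoring.tauInt`: for a bounded
measurable `π`-centred `f` with `∫ f² dπ ≠ 0` and any bounded measurable Poisson solution `h`,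
`τ_int(f) = ∫ f h dπ / ∫ f² dπ − 1/2`. -/
theorem tauInt_eq_of_poisson (hπ : Kernel.Invariant κ π)
    (hmin : ∀ x {B : Set Ω}, MeasurableSet B → ε * π B ≤ κ x B) (hε0 : 0 < ε) {f h : Ω → ℝ}
    (hf : Measurable f) {Cf : ℝ} (hCf : ∀ x, |f x| ≤ Cf) (hf0 : ∫ x, f x ∂π = 0)
    (hh : Measurable h) {Ch : ℝ} (hCh : ∀ x, |h x| ≤ Ch) (hpois : ∀ x, h x - kop κ h x = f x)
    (hV : ∫ x, f x ^ 2 ∂π ≠ 0) :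
    tauInt (fun t => autocov κ π f t / autocov κ π f 0)
      = (∫ x, f x * h x ∂π) / (∫ x, f x ^ 2 ∂π) - 1 / 2 := by
  have hGK := greenKubo_hasSum_of_poisson hπ hmin hε0 hf hCf hf0 hh hCh hpois
  have h1 : HasSum (fun t => autocov κ π f (t + 1)) (∫ x, f x * h x ∂π - ∫ x, f x ^ 2 ∂π) := by
    have := (hasSum_nat_add_iff' (f := fun t => autocov κ π f t) 1).2 hGK
    simpa [Finset.sum_range_one, autocov_zero] using this
  unfold tauInt
  rw [autocov_zero, (h1.div_const _).tsum_eq]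
  field_simp
  ring

/-! ### A bounded Poisson solution exists (Neumann series) -/

/-- **Existence of a bounded measurable Poisson solution** for every bounded measurable
`π`-centred `f`: the Neumann series `h x = Σ_{t ≥ 0} (kop κ)^[t] f x` converges absolutely
(`|(kop κ)^[t] f| ≤ (1 − ε/2)ᵗ C`), is measurable, bounded by `2C/ε`, and solves
`h − kop κ h = f`. -/
theorem poisson_exists_of_doeblin (hπ : Kernel.Invariant κ π)
    (hmin : ∀ x {B : Set Ω}, MeasurableSet B → ε * π B ≤ κ x B) (hε0 : 0 < ε) {f : Ω → ℝ}
    (hf : Measurable f) {C : ℝ} (hC : ∀ x, |f x| ≤ C) (hf0 : ∫ x, f x ∂π = 0) :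
    ∃ h : Ω → ℝ, Measurable h ∧ (∀ x, |h x| ≤ 2 * C / ε.toReal) ∧
      ∀ x, h x - kop κ h x = f x := by
  obtain ⟨-, hl0, hl1, -, hr, hεr0⟩ := half_const_bounds hmin hε0
  have hdecay := fun t x => abs_iterate_kop_le_of_doeblin hπ hmin hε0 hf hC hf0 t x
  have hgeo : HasSum (fun t : ℕ => (1 - (ε / 2).toReal) ^ t * C) (2 * C / ε.toReal) := by
    have h := (hasSum_geometric_of_lt_one hl0 hl1).mul_right C
    have he : (1 - (1 - (ε / 2).toReal))⁻¹ * C = 2 * C / ε.toReal := by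
      rw [sub_sub_cancel, hr]
      field_simp
    rwa [he] at h
  have hsum : ∀ x, Summable fun t => (kop κ)^[t] f x := fun x =>
    Summable.of_norm_bounded hgeo.summable fun t => by
      rw [Real.norm_eq_abs]; exact hdecay t x
  -- partial sums
  set S : ℕ → Ω → ℝ := fun N x => ∑ t ∈ Finset.range N, (kop κ)^[t] f x with hS
  have hSm : ∀ N, Measurable (S N) := fun N =>
    Finset.measurable_sum _ fun t _ => (iterate_kop_bounded_measurable κ hf hC t).1
  have hSb : ∀ N x, |S N x| ≤ 2 * C / ε.toReal := by
    intro N x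
    calc |S N x| ≤ ∑ t ∈ Finset.range N, |(kop κ)^[t] f x| := Finset.abs_sum_le_sum_abs _ _
      _ ≤ ∑ t ∈ Finset.range N, (1 - (ε / 2).toReal) ^ t * C :=
          Finset.sum_le_sum fun t _ => hdecay t x
      _ ≤ 2 * C / ε.toReal :=
          sum_le_hasSum _ (fun t _ => mul_nonneg (pow_nonneg hl0 t)
            ((abs_nonneg _).trans (hC x))) hgeo
  have hlim : ∀ x, Tendsto (fun N => S N x) atTop (𝓝 (∑' t, (kop κ)^[t] f x)) := fun x =>
    (hsum x).hasSum.tendsto_sum_nat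
  refine ⟨fun x => ∑' t, (kop κ)^[t] f x, ?_, ?_, fun x => ?_⟩
  · -- measurable: pointwise limit of the measurable partial sums
    exact measurable_of_tendsto_metrizable hSm (tendsto_pi_nhds.2 hlim)
  · intro x
    have h1 := tsum_of_norm_bounded hgeo fun t => by rw [Real.norm_eq_abs]; exact hdecay t x
    rwa [Real.norm_eq_abs] at h1
  · -- the Poisson equation: `S (N+1) = f + kop κ (S N)`, then dominated convergence
    have hrec : ∀ N, S (N + 1) x = f x + kop κ (S N) x := by
      intro N
      have hlin : kop κ (S N) x = ∑ t ∈ Finset.range N, (kop κ)^[t + 1] f x := by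
        show ∫ y, (∑ t ∈ Finset.range N, (kop κ)^[t] f y) ∂(κ x) = _
        rw [integral_finsetSum _ fun t _ => ?_]
        · refine Finset.sum_congr rfl fun t _ => ?_
          rw [Function.iterate_succ_apply']
          rfl
        · obtain ⟨hm, hb⟩ := iterate_kop_bounded_measurable κ hf hC t
          exact integrable_of_bounded _ hm hb
      rw [hlin]
      show ∑ t ∈ Finset.range (N + 1), (kop κ)^[t] f x = _
      rw [Finset.sum_range_succ']
      simp only [Function.iterate_zero, id_eq]
      ring
    -- kop κ (S N) x → kop κ h x by dominated convergence (bound: the constant 2C/ε)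
    have hdct : Tendsto (fun N => kop κ (S N) x) atTop
        (𝓝 (kop κ (fun y => ∑' t, (kop κ)^[t] f y) x)) := by
      unfold kop
      refine tendsto_integral_of_dominated_convergence (fun _ => 2 * C / ε.toReal)
        (fun N => (hSm N).aestronglyMeasurable) (integrable_const _) (fun N => ae_of_all _ fun y => ?_)
        (ae_of_all _ fun y => hlim y)
      rw [Real.norm_eq_abs]
      exact hSb N y
    -- pass to the limit in the recursion
    have hlim1 : Tendsto (fun N => S (N + 1) x) atTop (𝓝 (∑' t, (kop κ)^[t] f x)) :=
      (hlim x).comp (tendsto_add_atTop_nat 1)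
    have hlim2 : Tendsto (fun N => S (N + 1) x) atTop
        (𝓝 (f x + kop κ (fun y => ∑' t, (kop κ)^[t] f y) x)) := by
      have := hdct.const_add (f x)
      exact this.congr fun N => (hrec N).symm
    have heq := tendsto_nhds_unique hlim1 hlim2
    linarith

/-! ### Row 11's finite-`N` variance of the mean: `τ_N → τ_int` -/

/-- The first absolute moment of the normalised autocorrelation is finite:
`Σ_t (t+1)|ρ_{t+1}| < ∞` (geometric envelope, `ε > 0`). -/
theorem summable_moment_acf_of_doeblin (hπ : Kernel.Invariant κ π)
    (hmin : ∀ x {B : Set Ω}, MeasurableSet B → ε * π B ≤ κ x B) (hε0 : 0 < ε) {f : Ω → ℝ}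
    (hf : Measurable f) {C : ℝ} (hC : ∀ x, |f x| ≤ C) (hf0 : ∫ x, f x ∂π = 0) :
    Summable fun t : ℕ => ((t : ℝ) + 1) * |autocov κ π f (t + 1) / autocov κ π f 0| := by
  have henv := fun t => abs_acf_le_of_doeblin hπ hmin hf hC hf0 t
  have hl0 := one_sub_toReal_nonneg_of_doeblin hmin
  obtain ⟨-, -, -, -, -, hεr0⟩ := half_const_bounds hmin hε0
  have hg : Summable fun t : ℕ => ((t : ℝ) + 1) * (1 - ε.toReal) ^ (t + 1) := by
    have hn : ‖(1 : ℝ) - ε.toReal‖ < 1 := by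
      rw [Real.norm_eq_abs, abs_of_nonneg hl0]; linarith
    have h0 : Summable fun n : ℕ => (n : ℝ) ^ 1 * (1 - ε.toReal) ^ n :=
      summable_pow_mul_geometric_of_norm_lt_one 1 hn
    have h1 : Summable fun n : ℕ => (((n + 1 : ℕ) : ℝ)) ^ 1 * (1 - ε.toReal) ^ (n + 1) :=
      (summable_nat_add_iff (f := fun n : ℕ => (n : ℝ) ^ 1 * (1 - ε.toReal) ^ n) 1).2 h0
    refine h1.congr fun t => ?_
    rw [pow_one, Nat.cast_add, Nat.cast_one]
  refine Summable.of_norm_bounded hg fun t => ?_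
  have ht : (0 : ℝ) ≤ (t : ℝ) + 1 := by positivity
  rw [Real.norm_eq_abs, abs_mul, abs_of_nonneg ht, abs_abs]
  exact mul_le_mul_of_nonneg_left (henv (t + 1)) ht

/-- **`τ_N → τ_int`** for every bounded measurable centred observable of a Markov kernel minorised
by its own invariant law (`ε > 0`): row 11's `Scoring.tendsto_tauIntN` — the finite-`N` variance of
the mean in units of `σ²/(2N)` converges to the figure of merit — with its hypothesis discharged. -/
theorem tendsto_tauIntN_of_doeblin (hπ : Kernel.Invariant κ π)
    (hmin : ∀ x {B : Set Ω}, MeasurableSet B → ε * π B ≤ κ x B) (hε0 : 0 < ε) {f : Ω → ℝ}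
    (hf : Measurable f) {C : ℝ} (hC : ∀ x, |f x| ≤ C) (hf0 : ∫ x, f x ∂π = 0) :
    Tendsto (fun N => tauIntN (fun t => autocov κ π f t / autocov κ π f 0) N) atTop
      (𝓝 (tauInt fun t => autocov κ π f t / autocov κ π f 0)) :=
  tendsto_tauIntN (summable_moment_acf_of_doeblin hπ hmin hε0 hf hC hf0)

end Summit.Ventures.LatticeQCDFlow.Scoring

end
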